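import Summits.HodgeConjecture.HodgeConjecture.Theorems.Ring2AbelianAllAndreTransposedInverses
import Summits.HodgeConjecture.HodgeConjecture.Theorems.Ring2AbelianAllAndreCorrespondenceCategory
import Literature.AlgebraicGeometry.HodgeTheory.HodgeRiemannPolarizabilityProofs
import Literature.AlgebraicGeometry.HodgeTheory.DominatedByPowersHodgeConjectureHolds
import Literature.AlgebraicGeometry.HodgeTheory.HodgeTypeVanishing
import Literature.AlgebraicGeometry.HodgeTheory.HodgeNumbersHardLefschetzDuality
import Literature.AlgebraicGeometry.HodgeTheory.LefschetzOneOneHolds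

/-!
# Route MarkmanPartnerTransport · crux `PicardThreeK3Squares` (stmt-HodgeConjecture-19652) —
# the Lefschetz–transpose of an algebraic correspondence and the Hodge–Riemann non-vanishing
# `(ᵗO ∘ L^{n-2} ∘ O) σ ≠ 0`

Programme «KS-SELF», step 3. Let `S` be a smooth projective surface, `Y` a smooth projective variety
of dimension `n ≥ 2` (the square `A × A` of a Kuga–Satake variety) and `O₁, O₂ : H²(S(ℂ); ℂ) →
H²(Y(ℂ); ℂ)` maps INDUCED BY ALGEBRAIC CYCLES on `Y × S`. With a rational Kähler class `η` of `Y`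
(algebraic by Lefschetz `(1,1)`) and the Poincaré transpose `ᵗO₁ : H^{2n-2}(Y) → H²(S)` of `O₁`
(`Ring2.AbelianAll.IsAlgebraicCorrespondence.exists_transpose`), the maps
`Φᵢ := ᵗO₁ ∘ L_η^{n-2} ∘ Oᵢ : H²(S(ℂ); ℂ) → H²(S(ℂ); ℂ)` are algebraic self-correspondences of `S`
(`.comp_lefschetzPow`, `.comp`), and:

* `exists_lefschetzTranspose` — **`Φ₁ σ ≠ 0`** for every class `σ` with `O₁ σ` a non-zero `(2,0)`-class
  and `O₁ σ̄ = \overline{O₁ σ}`: by Hodge–Riemann on `Y` (`KaehlerRationalDatum.hodgeRiemann_X`: for the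
  PRIMITIVE `(2,0)`-class `ξ = O₁σ` — primitive since `L^{n-1}ξ` has type `(n+1, n-1)` —
  `L^{n-2} ξ ∪ ξ̄ = t Ω`, `t > 0`), so `⟨O₁ σ̄, L^{n-2} O₁ σ⟩_Y ≠ 0`, which is `± ⟨Φ₁ σ, σ̄⟩_S` by the
  adjunction of the transpose. Both `Φᵢ` factor as `R ∘ Oᵢ` through ONE map `R = ᵗO₁ ∘ L^{n-2}`.

This is the elementary half of Varesco's Lemma 4.4 ("`δ ∘ κ^∨ ∘ L^{2N-2} ∘ κ|_T = c · id`, `c ≠ 0`":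
the NON-VANISHING, from Hodge–Riemann in degree `2` on the Kuga–Satake side), without its deformation
half ("multiple of the identity"), which the programme replaces by the subfield trick (sequel).
THEOREMS ONLY; no definition, no named fact, no sorry; credits nothing to the Hodge conjecture. Prover
seat hodge-nonav-19652-p1 (gen 14), `--supports stmt-HodgeConjecture-19652`.

References: M. Varesco, Math. Z. 305 (2023), Lemma 4.4 (first half of the proof) and Thm. 4.5;
C. Voisin, *Hodge Theory I* (2002), §6.3.2 Thm. 6.32 (Hodge–Riemann), §6.2.3 (Lefschetz
decomposition), Thm. 11.30; W. Fulton, *Intersection Theory*, §16.1 (correspondences, transpose).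
-/

set_option linter.dupNamespace false

noncomputable section

namespace Summit.HodgeConjecture.HodgeConjecture.Theorems.MarkmanPartnerTransport.KugaSatakeSelf

open scoped TensorProduct
open CategoryTheory MonoidalCategory Literature.AlgebraicGeometry Literature.AlgebraicGeometry.Motives
open Literature.AlgebraicGeometry.HodgeTheory Literature.AlgebraicTopology.SingularHomology
open Literature.Geometry.Kaehler (lefschetzPow lefschetzPow_zero lefschetzPow_succ lefschetzOperator_apply)
open Summit.HodgeConjecture.HodgeConjecture.Ring2.AbelianAll

variable {S Y : SchemeOver ℂ} {n : ℕ}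

/-! ### §1 Algebraic correspondences preserve Hodge types and the lattice of a `(2,0)`-class -/

/-- **An algebraic correspondence `H²(S) → H²(Y)` maps `(2,0)`-classes to `(2,0)`-classes** (it is
`[γ]_*` for an algebraic, hence type-`(e,e)`, class `γ`; `isOfHodgeType_corrAction_complex`).
[cite: VoisinHodgeI2002, §11.3.3 Lemma 11.41] -/
theorem isOfHodgeType_two_zero_of_isAlgebraicCorrespondence (hY : IsSmoothProjective n Y)
    (hS : IsSmoothProjective 2 S) {O : complexBetti S (2 * 1) →ₗ[ℂ] complexBetti Y 2}
    (hO : IsAlgebraicCorrespondence n 2 Y S O) {σ : complexBetti S (2 * 1)}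
    (hσ : IsOfHodgeType 2 S (2 * 1) 2 0 σ) : IsOfHodgeType n Y 2 2 0 (O σ) := by
  obtain ⟨e, hab, γ, hγ, rfl⟩ := IsAlgebraicCorrespondence.exists_eq_corrAction hY hS hO
  have hγt : IsOfHodgeType (n + 2) (Y ⊗ S) (2 * e) e e γ :=
    isOfHodgeType_of_mem_algebraicClasses_of_isSmoothProjective (hY.tensor_holds hS) e hγ
  exact Arapura2006.isOfHodgeType_corrAction_complex hY hS hab hγt (by omega) (by omega) hσ

/-! ### §2 Hodge–Riemann for a `(2,0)`-class on `Y` -/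

/-- **A `(2,0)`-class is primitive**: `L_η^{r+1} ξ = 0` when `2 + r = n` (the class `η^{r+1} ξ` has
type `(n+1, n-1)` in degree `2n`). [cite: VoisinHodgeI2002, §6.2.3 and Rem. 6.27] -/
theorem lefschetzPow_eq_zero_of_two_zero (hY : IsSmoothProjective n Y) (D : KaehlerRationalDatum n Y)
    {r : ℕ} (hr : 2 + r = n) {ξ : complexBetti Y 2} (hξ : IsOfHodgeType n Y 2 2 0 ξ) :
    lefschetzPow D.Hη (r + 1) 2 ξ = 0 := by
  have h := D.isOfHodgeType_lefschetzPowTo hY (r + 1) 2 (2 + 2 * (r + 1)) rfl 2 0 ξ hξ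
  rw [lefschetzPowTo_eq_lefschetzPow] at h
  exact h.eq_zero_of_lt hY (Or.inl (by omega))

/-- **Hodge–Riemann non-vanishing on `Y`**: for a non-zero `(2,0)`-class `ξ` and `2 + r = n`, the
Poincaré pairing `⟨ξ̄, L_η^{r} ξ⟩_Y ≠ 0` (`KaehlerRationalDatum.hodgeRiemann_X`: `L^r ξ ∪ ξ̄ = t Ω`,
`t > 0`, `Ω ≠ 0`; graded commutativity in even degrees). [cite: VoisinHodgeI2002, §6.3.2 Thm. 6.32] -/
theorem cupPairing_conj_lefschetzPow_ne_zero (hY : IsSmoothProjective n Y) (D : KaehlerRationalDatum n Y)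
    {r : ℕ} (hr : 2 + r = n) (hb : 2 + (2 + 2 * r) = 2 * n) {ξ : complexBetti Y 2}
    (hξ : IsOfHodgeType n Y 2 2 0 ξ) (hξ0 : ξ ≠ 0) :
    cupPairing (complexOrientationFamily hY) hb (conjClass _ 2 ξ) (lefschetzPow D.Hη r 2 ξ) ≠ 0 := by
  have h2 : (2 + 2 * r) + 2 = 2 * n := by omega
  have hprim := lefschetzPow_eq_zero_of_two_zero hY D hr hξ
  obtain ⟨t, ht, heq⟩ := D.hodgeRiemann_X hY (a := 2) (s := 2) (t' := 0) (r₀ := r) hr h2 hξ hξ0 hprim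
  have hsign : Complex.I ^ ((2 : ℕ) - (0 : ℕ) : ℤ) * (-1 : ℂ) ^ (2 * (2 - 1) / 2) = 1 := by
    norm_num [zpow_two, Complex.I_sq]
  rw [hsign, one_smul] at heq
  -- `L^r ξ ∪ ξ̄ ≠ 0` in the top degree
  have hne : cupProduct h2 (lefschetzPow D.Hη r 2 ξ) (conjClass _ 2 ξ) ≠ 0 := by
    rw [heq]
    exact smul_ne_zero (by exact_mod_cast ht.ne') (D.topClass_ne_zero hY)
  -- graded commutativity (even degrees) and the Kronecker pairing with `[Y]`
  have hcomm := cupProduct_gradedComm_holds ℂ (Motives.ComplexPoints Y) hb h2 (conjClass _ 2 ξ)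
    (lefschetzPow D.Hη r 2 ξ)
  have heven : ((-1 : ℂ) ^ (2 * (2 + 2 * r))) = 1 := Even.neg_one_pow ⟨2 + 2 * r, by ring⟩
  rw [heven, one_smul] at hcomm
  intro h0
  rw [cupPairing_apply, hcomm] at h0
  apply hne
  apply eq_zero_of_traceC_eq_zero hY
  rw [traceC_apply, h0, mul_zero]

/-! ### §3 The Lefschetz–transpose -/

/-- **THE LEFSCHETZ–TRANSPOSE CORRESPONDENCES.** Let `S` be a smooth projective surface, `Y` smooth
projective of dimension `n ≥ 2`, and `O₁, O₂ : H²(S(ℂ); ℂ) → H²(Y(ℂ); ℂ)` induced by algebraic cycles.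
Then there is ONE `ℂ`-linear `R : H²(Y(ℂ); ℂ) → H²(S(ℂ); ℂ)` (namely `ᵗO₁ ∘ L_η^{n-2}` for a rational
Kähler class `η` of `Y`) such that `R ∘ O₁` and `R ∘ O₂` are ALGEBRAIC self-correspondences of `S`, and
`(R ∘ O₁) σ ≠ 0` for every `σ ∈ H²(S(ℂ); ℂ)` whose image `O₁ σ` is a non-zero `(2,0)`-class with
`O₁ σ̄ = \overline{O₁ σ}` (Hodge–Riemann on `Y` + the adjunction `⟨O₁ x, w⟩_Y = ⟨ᵗO₁ w, x⟩_S`).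
[cite: Varesco2023, Lemma 4.4 and Thm. 4.5] [cite: VoisinHodgeI2002, §6.3.2 Thm. 6.32] [cite: Fulton1998, §16.1] -/
theorem exists_lefschetzTranspose (hS : IsSmoothProjective 2 S) (hY : IsSmoothProjective n Y) (hn : 2 ≤ n)
    {O₁ O₂ : complexBetti S (2 * 1) →ₗ[ℂ] complexBetti Y 2}
    (hO₁ : IsAlgebraicCorrespondence n 2 Y S O₁) (hO₂ : IsAlgebraicCorrespondence n 2 Y S O₂) :
    ∃ R : complexBetti Y 2 →ₗ[ℂ] complexBetti S (2 * 1),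
      IsAlgebraicCorrespondence 2 2 S S (R ∘ₗ O₁) ∧ IsAlgebraicCorrespondence 2 2 S S (R ∘ₗ O₂) ∧
      ∀ σ : complexBetti S (2 * 1), IsOfHodgeType n Y 2 2 0 (O₁ σ) → O₁ σ ≠ 0 →
        O₁ (conjClass _ (2 * 1) σ) = conjClass _ 2 (O₁ σ) → (R ∘ₗ O₁) σ ≠ 0 := by
  obtain ⟨r, hr⟩ : ∃ r, 2 + r = n := ⟨n - 2, by omega⟩
  obtain ⟨D⟩ := nonempty_kaehlerRationalDatum hY
  -- the rational Kähler class is algebraic (Lefschetz `(1,1)`)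
  have hη : D.Hη ∈ algebraicClasses Y 1 :=
    lefschetzOneOne_rational_holds hY _ D.isRationalClass_Hη D.isOfHodgeType_Hη
  -- the transpose of `O₁`
  have ha : 2 * 1 + 2 * 1 = 2 * 2 := rfl
  have hb : 2 + (2 + 2 * r) = 2 * n := by omega
  obtain ⟨Tt, hTt, hadj⟩ := IsAlgebraicCorrespondence.exists_transpose hY hS ha hb hO₁
  -- `R := ᵗO₁ ∘ L^r`
  have hR : IsAlgebraicCorrespondence 2 n S Y (Tt ∘ₗ lefschetzPow D.Hη r 2) :=
    IsAlgebraicCorrespondence.comp_lefschetzPow hS hY hη 2 r hTt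
  refine ⟨Tt ∘ₗ lefschetzPow D.Hη r 2,
    IsAlgebraicCorrespondence.comp hS hY hS hO₁ hR (by omega),
    IsAlgebraicCorrespondence.comp hS hY hS hO₂ hR (by omega), fun σ hσ hσ0 hconj h0 => ?_⟩
  have hHR := cupPairing_conj_lefschetzPow_ne_zero hY D hr hb hσ hσ0
  apply hHR
  have key := hadj (conjClass _ (2 * 1) σ) (lefschetzPow D.Hη r 2 (O₁ σ))
  have heven : ((-1 : ℂ) ^ (2 * 1 * (2 + 2 * r))) = 1 := Even.neg_one_pow ⟨2 + 2 * r, by ring⟩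
  rw [hconj, heven, one_mul] at key
  rw [key]
  have h0' : Tt (lefschetzPow D.Hη r 2 (O₁ σ)) = 0 := by
    rw [LinearMap.comp_apply, LinearMap.comp_apply] at h0
    exact h0
  rw [h0', map_zero, LinearMap.zero_apply]

end Summit.HodgeConjecture.HodgeConjecture.Theorems.MarkmanPartnerTransport.KugaSatakeSelf

end
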